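import Literature.Analysis.FluidPDE.ElgindiWkSupBounds
import Literature.Analysis.FluidPDE.ElgindiHkNonDensity
import Literature.Analysis.FluidPDE.ElgindiProfileTail
import Mathlib.Algebra.Order.Chebyshev
import HarnessLib

/-!
# The second product rule: `|fg|_{𝓗⁴} ≲ |f|_{𝓦^{4,∞}}|g|_{𝓗⁴}` for test functions `g`
([ElgindiGhoulMasmoudi2021] §9 Proposition 9.3; [Elgindi2021] §8.1 Lemma 8.6)

Topic `Literature/Analysis/FluidPDE`. Support file (definitions with bodies and proved theorems, no
named facts) on the proof path of the named fact
`Literature.Analysis.FluidPDE.Elgindi.ElgindiGhoulMasmoudi2021_stabilityCore`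
(`ElgindiStabilityDecomposition.lean`). T. M. Elgindi, T.-E. Ghoul, N. Masmoudi, Camb. J. Math. 9
(2021) = arXiv:1910.14071, §9 Proposition 9.3 (p. 20): "Let `f ∈ 𝓗ᵏ` and `g ∈ 𝓦^{k,∞}`. Then
`fg ∈ 𝓗ᵏ` and `|fg|_{𝓗ᵏ} ≤ (C/√(γ−1))|f|_{𝓗ᵏ}|g|_{𝓦^{k,∞}}`. Proof. As in [E_Classical], whenever
derivatives fall onto `g` we can take them out of the integral."

At `k = 4`, for `f` smooth on the open strip with `|f|_{𝓦^{4,∞}} ≤ M` and a test function `g` of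
the open strip: `|fg|²_{𝓗⁴} ≤ C·M²·|g|²_{𝓗⁴}` with an absolute constant `C` (`eHkNormSq_mul_le_wk`).
The words of `fg` are expanded by the Leibniz formula on the strip; the factor of `f` is bounded a.e.
by `C·M` (`ElgindiWkSupBounds.lean`), with the extra factor `γ − 1 + sin 2θ` when all angular
derivatives fall on `f` — that factor converts the `γ`-weight of the word into the `η`-weight of the
radial `𝓗⁴`-term of `g` up to `(γ−1)²sin(2θ)^{−γ}`, which the `γ`-Hardy inequality for test
functions (`lintegral_radialWord_rpow_neg_gamma_le`, constant `(π/(γ−1))²`) absorbs. So at `k = 4`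
the constant does not even degenerate as `γ → 1`.
-/

noncomputable section

open MeasureTheory Set Function Real Filter Finset
open _root_.Topology
open scoped ENNReal ContDiff

namespace Literature.Analysis.FluidPDE

namespace Elgindi

/-! ### The radial integral with the factor `q² = (γ − 1 + sin 2θ)²` -/

/-- **`∫∫ q²·Y²·w²·sin(2θ)^{−γ} ≤ (2π² + 2)|g|²_{𝓗⁴}`** for the radial words `Y = D_z^m g` (`m ≤ 3`) of a
test function `g`, `0 < α ≤ 10`: `q² ≤ 2(γ−1)² + 2sin²(2θ)`, the first part by the `γ`-Hardy
inequality, the second since `sin(2θ)^{2−γ} ≤ sin(2θ)^{−η}`. [cite: ElgindiGhoulMasmoudi2021, §9 Proposition 9.3 (p. 20 of arXiv:1910.14071)] -/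
theorem lintegral_qsq_radialWord_le {α : ℝ} (hα : 0 < α) (hα10 : α ≤ 10) {g : ℝ → ℝ → ℝ} (hg : StripTest g) {m : ℕ} (hm : m ≤ 3) :
    ∫⁻ p in strip, ENNReal.ofReal (qW α p.2 ^ 2 * ((Dz^[m] g) p.1 p.2) ^ 2 * totalWeight α p.1 p.2 ^ 2) ≤
      ENNReal.ofReal (2 * π ^ 2 + 2) * eHkNormSq α 4 g := by
  set γ := gammaExp α with hγ
  have hγ1 : 0 < γ - 1 := by unfold gammaExp at hγ; rw [hγ]; linarith
  have hγ2 : γ ≤ 2 := by unfold gammaExp at hγ; rw [hγ]; linarith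
  -- pointwise split
  have hpt : ∀ p ∈ strip, ENNReal.ofReal (qW α p.2 ^ 2 * ((Dz^[m] g) p.1 p.2) ^ 2 * totalWeight α p.1 p.2 ^ 2) ≤
      ENNReal.ofReal (2 * (γ - 1) ^ 2) * ENNReal.ofReal (radialWeight p.1 ^ 2 * ((Dz^[m] g) p.1 p.2) ^ 2 * Real.sin (2 * p.2) ^ (-γ)) +
        2 * ENNReal.ofReal ((hkRadialTerm m g p.1 p.2) ^ 2) := by
    intro p hp
    have hs : 0 < Real.sin (2 * p.2) := Real.sin_pos_of_pos_of_lt_pi (by linarith [hp.2.1]) (by linarith [hp.2.2])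
    have hs1 : Real.sin (2 * p.2) ≤ 1 := Real.sin_le_one _
    have eW : totalWeight α p.1 p.2 ^ 2 = radialWeight p.1 ^ 2 * Real.sin (2 * p.2) ^ (-γ) := totalWeight_sq_eq α hp
    have eR : (hkRadialTerm m g p.1 p.2) ^ 2 = ((Dz^[m] g) p.1 p.2) ^ 2 * (radialWeight p.1 ^ 2 * Real.sin (2 * p.2) ^ (-eta)) := by
      simp only [hkRadialTerm]; rw [mul_pow, hWeight_sq_eq hp]
    -- `sin^{2−γ} ≤ sin^{−η}`
    have hpow : Real.sin (2 * p.2) ^ 2 * Real.sin (2 * p.2) ^ (-γ) ≤ Real.sin (2 * p.2) ^ (-eta) := by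
      rw [← Real.rpow_natCast, ← Real.rpow_add hs]
      exact Real.rpow_le_rpow_of_exponent_ge hs hs1 (by unfold eta; push_cast; linarith)
    have hq : qW α p.2 ^ 2 ≤ 2 * (γ - 1) ^ 2 + 2 * Real.sin (2 * p.2) ^ 2 := by
      unfold qW; rw [← hγ]; nlinarith [sq_nonneg (γ - 1 - Real.sin (2 * p.2))]
    rw [← ENNReal.ofReal_ofNat 2, ← ENNReal.ofReal_mul (by positivity), ← ENNReal.ofReal_mul (by norm_num),
      ← ENNReal.ofReal_add (by positivity) (by positivity)]
    refine ENNReal.ofReal_le_ofReal ?_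
    rw [eW, eR]
    have hY := sq_nonneg ((Dz^[m] g) p.1 p.2)
    have hw := sq_nonneg (radialWeight p.1)
    have hsγ : 0 ≤ Real.sin (2 * p.2) ^ (-γ) := Real.rpow_nonneg hs.le _
    calc qW α p.2 ^ 2 * ((Dz^[m] g) p.1 p.2) ^ 2 * (radialWeight p.1 ^ 2 * Real.sin (2 * p.2) ^ (-γ))
        ≤ (2 * (γ - 1) ^ 2 + 2 * Real.sin (2 * p.2) ^ 2) * ((Dz^[m] g) p.1 p.2) ^ 2 * (radialWeight p.1 ^ 2 * Real.sin (2 * p.2) ^ (-γ)) := by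
          gcongr
      _ = 2 * (γ - 1) ^ 2 * (radialWeight p.1 ^ 2 * ((Dz^[m] g) p.1 p.2) ^ 2 * Real.sin (2 * p.2) ^ (-γ)) +
            2 * (((Dz^[m] g) p.1 p.2) ^ 2 * radialWeight p.1 ^ 2 * (Real.sin (2 * p.2) ^ 2 * Real.sin (2 * p.2) ^ (-γ))) := by ring
      _ ≤ 2 * (γ - 1) ^ 2 * (radialWeight p.1 ^ 2 * ((Dz^[m] g) p.1 p.2) ^ 2 * Real.sin (2 * p.2) ^ (-γ)) +
            2 * (((Dz^[m] g) p.1 p.2) ^ 2 * radialWeight p.1 ^ 2 * Real.sin (2 * p.2) ^ (-eta)) := by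
          gcongr
      _ = _ := by ring
  -- integrate
  have mR : AEMeasurable (fun p : ℝ × ℝ => ENNReal.ofReal (radialWeight p.1 ^ 2 * ((Dz^[m] g) p.1 p.2) ^ 2 * Real.sin (2 * p.2) ^ (-γ))) (volume.restrict strip) := by
    have hc : ContinuousOn (fun p : ℝ × ℝ => radialWeight p.1 ^ 2 * ((Dz^[m] g) p.1 p.2) ^ 2 * Real.sin (2 * p.2) ^ (-γ)) strip := by
      refine ((ContinuousOn.pow ?_ 2).mul (((hg.smooth.ofIterDz m 0).continuous.continuousOn).pow 2)).mul ?_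
      · unfold radialWeight
        exact ContinuousOn.div (by fun_prop) (by fun_prop) fun p hp => pow_ne_zero 2 (ne_of_gt hp.1)
      · exact ContinuousOn.rpow_const (by fun_prop) fun p hp => Or.inl (Real.sin_pos_of_pos_of_lt_pi (by linarith [hp.2.1]) (by linarith [hp.2.2])).ne'
    exact (hc.aemeasurable measurableSet_strip).ennreal_ofReal
  calc ∫⁻ p in strip, ENNReal.ofReal (qW α p.2 ^ 2 * ((Dz^[m] g) p.1 p.2) ^ 2 * totalWeight α p.1 p.2 ^ 2)
      ≤ ∫⁻ p in strip, (ENNReal.ofReal (2 * (γ - 1) ^ 2) * ENNReal.ofReal (radialWeight p.1 ^ 2 * ((Dz^[m] g) p.1 p.2) ^ 2 * Real.sin (2 * p.2) ^ (-γ)) +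
          2 * ENNReal.ofReal ((hkRadialTerm m g p.1 p.2) ^ 2)) := setLIntegral_mono' measurableSet_strip hpt
    _ = ENNReal.ofReal (2 * (γ - 1) ^ 2) * (∫⁻ p in strip, ENNReal.ofReal (radialWeight p.1 ^ 2 * ((Dz^[m] g) p.1 p.2) ^ 2 * Real.sin (2 * p.2) ^ (-γ))) +
          2 * ∫⁻ p in strip, ENNReal.ofReal ((hkRadialTerm m g p.1 p.2) ^ 2) := by
        rw [lintegral_add_left' (mR.const_mul _), lintegral_const_mul'' _ mR, lintegral_const_mul' _ _ ENNReal.ofNat_ne_top]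
    _ ≤ ENNReal.ofReal (2 * (γ - 1) ^ 2) * (ENNReal.ofReal ((π / (γ - 1)) ^ 2) * eHkNormSq α 4 g) + 2 * eHkNormSq α 4 g := by
        refine add_le_add (mul_le_mul_right (lintegral_radialWord_rpow_neg_gamma_le hα hα10 hg hm) _) (mul_le_mul_right ?_ _)
        rw [← eL2Sq_eq_lintegral_ofReal]
        exact eL2Sq_hkRadialTerm_le α (by omega) g
    _ = ENNReal.ofReal (2 * π ^ 2 + 2) * eHkNormSq α 4 g := by
        rw [← mul_assoc, ← ENNReal.ofReal_mul (by positivity), ← add_mul]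
        congr 1
        rw [show 2 * (γ - 1) ^ 2 * (π / (γ - 1)) ^ 2 = 2 * π ^ 2 by field_simp]
        rw [← ENNReal.ofReal_ofNat 2, ← ENNReal.ofReal_add (by positivity) (by norm_num)]

/-! ### The terms of the Leibniz expansion -/

section terms

variable {α : ℝ} (hα : 0 < α) (hα10 : α ≤ 10) {f g : ℝ → ℝ → ℝ} (hf : ContDiffOn ℝ ∞ (uncurry f) strip)
  {B : ℝ} (hB0 : 0 ≤ B)
  (hB : ∀ᵐ p ∂(volume.restrict strip), ∀ i j : ℕ, i + j ≤ 4 →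
    |(Dθ^[i] (Dz^[j] f)) p.1 p.2| ≤ (if i = 0 then 1 else qW α p.2) * B)
  (hg : StripTest g)
include hα hα10 hf hB0 hB hg

/-- The uniform per-term constant `4·(2π² + 2)`. [folklore] -/
def termBC : ℝ := 4 * (2 * π ^ 2 + 2)

omit hα hα10 hf hB0 hB hg in
/-- `0 ≤ termBC`. [folklore] -/
theorem termBC_nonneg : 0 ≤ termBC := by
  unfold termBC
  have := Real.pi_pos
  positivity

omit hf in
/-- **The bound on one Leibniz term**: for `l ≤ i`, `k ≤ j`, `i + j ≤ 4`
(with the a.e. word bounds `|D^{l,k}f| ≤ (1 or q)·B` of a multiplier), `∫∫ (D^{l,k}f)²(D^{i−l,j−k}g)²ω_i² ≤ termBC·B²·|g|²_{𝓗⁴}`. [cite: ElgindiGhoulMasmoudi2021, §9 Proposition 9.3 (p. 20 of arXiv:1910.14071)] -/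
theorem lintegral_leibnizTerm_le {i j : ℕ} (hij : i + j ≤ 4) {l k : ℕ} (hl : l ≤ i) (hk : k ≤ j) :
    ∫⁻ p in strip, ENNReal.ofReal (((Dθ^[l] (Dz^[k] f)) p.1 p.2) ^ 2 * ((Dθ^[i - l] (Dz^[j - k] g)) p.1 p.2) ^ 2 * wordWeight α i p.1 p.2 ^ 2) ≤
      ENNReal.ofReal (termBC * B ^ 2) * eHkNormSq α 4 g := by
  set B2 : ℝ := 2 * B with hB2
  have hB20 : 0 ≤ B2 := by rw [hB2]; positivity
  -- the a.e. pointwise bound on the `f`-factor, in two flavours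
  have hbd : ∀ᵐ p ∂(volume.restrict strip), |(Dθ^[l] (Dz^[k] f)) p.1 p.2| ≤ B2 ∧
      (1 ≤ l → |(Dθ^[l] (Dz^[k] f)) p.1 p.2| ≤ qW α p.2 * B) := by
    filter_upwards [hB, ae_restrict_mem measurableSet_strip] with p hp hps
    have h := hp l k (by omega)
    obtain ⟨hq0, hq2⟩ := qW_mem hα hα10 hps.2
    refine ⟨h.trans ?_, fun hl1 => by rwa [if_neg (by omega)] at h⟩
    split_ifs at h ⊢ with h0
    · rw [hB2]; nlinarith
    · rw [hB2]; nlinarith [mul_nonneg (sub_nonneg.2 hq2) hB0]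
  by_cases hli : l < i
  · -- the `g`-word keeps `i − l ≥ 1` angular derivatives: `ω_i = W` and the mixed term of `g`
    have hi0 : i ≠ 0 := by omega
    calc ∫⁻ p in strip, ENNReal.ofReal (((Dθ^[l] (Dz^[k] f)) p.1 p.2) ^ 2 * ((Dθ^[i - l] (Dz^[j - k] g)) p.1 p.2) ^ 2 * wordWeight α i p.1 p.2 ^ 2)
        ≤ ∫⁻ p in strip, ENNReal.ofReal (B2 ^ 2) * ENNReal.ofReal ((hkMixedTerm α (i - l) (j - k) g p.1 p.2) ^ 2) := by
          refine lintegral_mono_ae (hbd.mono fun p hp => ?_)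
          rw [← ENNReal.ofReal_mul (sq_nonneg _)]
          refine ENNReal.ofReal_le_ofReal ?_
          simp only [hkMixedTerm, wordWeight, if_neg hi0]
          have h2 : ((Dθ^[l] (Dz^[k] f)) p.1 p.2) ^ 2 ≤ B2 ^ 2 := by
            have := hp.1; rw [← sq_abs]; exact pow_le_pow_left₀ (abs_nonneg _) this 2
          nlinarith [sq_nonneg ((Dθ^[i - l] (Dz^[j - k] g)) p.1 p.2 * totalWeight α p.1 p.2)]
      _ = ENNReal.ofReal (B2 ^ 2) * eL2Sq (hkMixedTerm α (i - l) (j - k) g) := by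
          rw [lintegral_const_mul' _ _ ENNReal.ofReal_ne_top, eL2Sq_eq_lintegral_ofReal]
      _ ≤ ENNReal.ofReal (B2 ^ 2) * eHkNormSq α 4 g := mul_le_mul_right (eL2Sq_hkMixedTerm_le α (by omega) (by omega) g) _
      _ ≤ ENNReal.ofReal (termBC * B ^ 2) * eHkNormSq α 4 g := by
          refine mul_le_mul_left (ENNReal.ofReal_le_ofReal ?_) _
          rw [hB2]; unfold termBC; nlinarith [sq_nonneg B, Real.pi_pos, sq_nonneg π]
  · have hli' : l = i := by omega
    subst hli'
    simp only [Nat.sub_self, Function.iterate_zero, id_eq]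
    rcases Nat.eq_zero_or_pos l with rfl | hl1
    · -- `i = l = 0`: radial word, `ω_0 = hWeight`, the radial term of `g`
      calc ∫⁻ p in strip, ENNReal.ofReal (((Dθ^[0] (Dz^[k] f)) p.1 p.2) ^ 2 * ((Dz^[j - k] g) p.1 p.2) ^ 2 * wordWeight α 0 p.1 p.2 ^ 2)
          ≤ ∫⁻ p in strip, ENNReal.ofReal (B2 ^ 2) * ENNReal.ofReal ((hkRadialTerm (j - k) g p.1 p.2) ^ 2) := by
            refine lintegral_mono_ae (hbd.mono fun p hp => ?_)
            rw [← ENNReal.ofReal_mul (sq_nonneg _)]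
            refine ENNReal.ofReal_le_ofReal ?_
            simp only [hkRadialTerm, wordWeight, if_true]
            have h2 : ((Dθ^[0] (Dz^[k] f)) p.1 p.2) ^ 2 ≤ B2 ^ 2 := by
              have := hp.1; rw [← sq_abs]; exact pow_le_pow_left₀ (abs_nonneg _) this 2
            nlinarith [sq_nonneg ((Dz^[j - k] g) p.1 p.2 * hWeight p.1 p.2)]
        _ = ENNReal.ofReal (B2 ^ 2) * eL2Sq (hkRadialTerm (j - k) g) := by
            rw [lintegral_const_mul' _ _ ENNReal.ofReal_ne_top, eL2Sq_eq_lintegral_ofReal]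
        _ ≤ ENNReal.ofReal (B2 ^ 2) * eHkNormSq α 4 g := mul_le_mul_right (eL2Sq_hkRadialTerm_le α (by omega) g) _
        _ ≤ ENNReal.ofReal (termBC * B ^ 2) * eHkNormSq α 4 g := by
            refine mul_le_mul_left (ENNReal.ofReal_le_ofReal ?_) _
            rw [hB2]; unfold termBC; nlinarith [sq_nonneg B, Real.pi_pos, sq_nonneg π]
    · -- `i = l ≥ 1`: all angular derivatives on `f`; `ω_i = W`, the radial word of `g` with the factor `q²`
      have hi0 : l ≠ 0 := by omega
      have hjk : j - k ≤ 3 := by omega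
      calc ∫⁻ p in strip, ENNReal.ofReal (((Dθ^[l] (Dz^[k] f)) p.1 p.2) ^ 2 * ((Dz^[j - k] g) p.1 p.2) ^ 2 * wordWeight α l p.1 p.2 ^ 2)
          ≤ ∫⁻ p in strip, ENNReal.ofReal (B ^ 2) * ENNReal.ofReal (qW α p.2 ^ 2 * ((Dz^[j - k] g) p.1 p.2) ^ 2 * totalWeight α p.1 p.2 ^ 2) := by
            refine lintegral_mono_ae (hbd.mono fun p hp => ?_)
            rw [← ENNReal.ofReal_mul (sq_nonneg _)]
            refine ENNReal.ofReal_le_ofReal ?_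
            simp only [wordWeight, if_neg hi0]
            have h2 : ((Dθ^[l] (Dz^[k] f)) p.1 p.2) ^ 2 ≤ B ^ 2 * qW α p.2 ^ 2 := by
              have := hp.2 hl1
              rw [← sq_abs, ← mul_pow]
              exact pow_le_pow_left₀ (abs_nonneg _) (by linarith) 2
            nlinarith [sq_nonneg ((Dz^[j - k] g) p.1 p.2 * totalWeight α p.1 p.2)]
        _ = ENNReal.ofReal (B ^ 2) * ∫⁻ p in strip, ENNReal.ofReal (qW α p.2 ^ 2 * ((Dz^[j - k] g) p.1 p.2) ^ 2 * totalWeight α p.1 p.2 ^ 2) := by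
            rw [lintegral_const_mul' _ _ ENNReal.ofReal_ne_top]
        _ ≤ ENNReal.ofReal (B ^ 2) * (ENNReal.ofReal (2 * π ^ 2 + 2) * eHkNormSq α 4 g) :=
            mul_le_mul_right (lintegral_qsq_radialWord_le hα hα10 hg hjk) _
        _ = ENNReal.ofReal (termBC * B ^ 2 / 4) * eHkNormSq α 4 g := by
            rw [← mul_assoc, ← ENNReal.ofReal_mul (sq_nonneg _)]
            congr 2; unfold termBC; ring
        _ ≤ ENNReal.ofReal (termBC * B ^ 2) * eHkNormSq α 4 g := by
            refine mul_le_mul_left (ENNReal.ofReal_le_ofReal ?_) _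
            nlinarith [mul_nonneg termBC_nonneg (sq_nonneg B)]

end terms

/-! ### The words of `fg` -/

/-- The constant of the word bound: `25·25·65536·termBC`. [folklore] -/
def wordBC : ℝ := 25 * 25 * 65536 * termBC

/-- `0 ≤ wordBC`. [folklore] -/
theorem wordBC_nonneg : 0 ≤ wordBC := by unfold wordBC; exact mul_nonneg (by norm_num) termBC_nonneg

/-- **One weighted word of `fg`** for a multiplier `f` with the a.e. word bounds `|D^{ij}f| ≤ (1 or q)·B`:
`‖D^{ij}(fg)·ω_i‖²_{L²} ≤ wordBC·B²·|g|²_{𝓗⁴}` (`i + j ≤ 4`). [cite: ElgindiGhoulMasmoudi2021, §9 Proposition 9.3 (p. 20 of arXiv:1910.14071)] -/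
theorem eL2Sq_word_mul_le_of_bounds {α : ℝ} (hα : 0 < α) (hα10 : α ≤ 10) {f g : ℝ → ℝ → ℝ} (hf : ContDiffOn ℝ ∞ (uncurry f) strip)
    {B : ℝ} (hB0 : 0 ≤ B) (hB : ∀ᵐ p ∂(volume.restrict strip), ∀ i j : ℕ, i + j ≤ 4 →
      |(Dθ^[i] (Dz^[j] f)) p.1 p.2| ≤ (if i = 0 then 1 else qW α p.2) * B) (hg : StripTest g) {i j : ℕ} (hij : i + j ≤ 4) :
    eL2Sq (fun z θ => (Dθ^[i] (Dz^[j] (f * g))) z θ * wordWeight α i z θ) ≤ ENNReal.ofReal (wordBC * B ^ 2) * eHkNormSq α 4 g := by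
  have hgs : ContDiffOn ℝ ∞ (uncurry g) strip := (contDiff_infty.2 hg.smooth).contDiffOn
  set T := (range (j + 1)) ×ˢ (range (i + 1)) with hT
  -- the terms
  set X : ℕ × ℕ → ℝ × ℝ → ℝ := fun t p => ((Dθ^[t.2] (Dz^[t.1] f)) p.1 p.2) * ((Dθ^[i - t.2] (Dz^[j - t.1] g)) p.1 p.2) with hX
  set c : ℕ × ℕ → ℝ := fun t => (j.choose t.1 : ℝ) * (i.choose t.2 : ℝ) with hc
  have hcard : (T.card : ℝ) ≤ 25 := by
    rw [hT, card_product, card_range, card_range]; exact_mod_cast (by nlinarith [show i + 1 ≤ 5 by omega, show j + 1 ≤ 5 by omega] : (j + 1) * (i + 1) ≤ 25)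
  have hcle : ∀ t ∈ T, c t ^ 2 ≤ 65536 := by
    intro t ht
    rw [hT, mem_product, Finset.mem_range, Finset.mem_range] at ht
    have h1 : (j.choose t.1 : ℝ) ≤ 16 := by
      have := Nat.choose_le_two_pow j t.1
      calc (j.choose t.1 : ℝ) ≤ (2:ℝ) ^ j := by exact_mod_cast this
        _ ≤ 2 ^ 4 := pow_le_pow_right₀ (by norm_num) (by omega)
        _ = 16 := by norm_num
    have h2 : (i.choose t.2 : ℝ) ≤ 16 := by
      have := Nat.choose_le_two_pow i t.2
      calc (i.choose t.2 : ℝ) ≤ (2:ℝ) ^ i := by exact_mod_cast this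
        _ ≤ 2 ^ 4 := pow_le_pow_right₀ (by norm_num) (by omega)
        _ = 16 := by norm_num
    have h0 : 0 ≤ c t := by simp only [hc]; positivity
    have : c t ≤ 256 := by simp only [hc]; nlinarith [Nat.cast_nonneg (α := ℝ) (j.choose t.1), Nat.cast_nonneg (α := ℝ) (i.choose t.2)]
    nlinarith
  -- pointwise on the strip: `(word·ω)² ≤ Σ_t 25·65536·X_t²ω²`
  have hpt : ∀ p ∈ strip, ENNReal.ofReal ((((Dθ^[i] (Dz^[j] (f * g))) p.1 p.2) * wordWeight α i p.1 p.2) ^ 2) ≤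
      ∑ t ∈ T, ENNReal.ofReal (25 * 65536) * ENNReal.ofReal ((X t p) ^ 2 * wordWeight α i p.1 p.2 ^ 2) := by
    intro p hp
    have hexp : (Dθ^[i] (Dz^[j] (f * g))) p.1 p.2 = ∑ t ∈ T, c t * X t p := by
      rw [iterate_Dθ_Dz_mul_strip hf hgs i j hp, hT, sum_product]
    rw [hexp]
    have hcs := sq_sum_le_card_mul_sum_sq (s := T) (f := fun t => c t * X t p)
    have hω := sq_nonneg (wordWeight α i p.1 p.2)
    have hreal : ((∑ t ∈ T, c t * X t p) * wordWeight α i p.1 p.2) ^ 2 ≤ ∑ t ∈ T, 25 * 65536 * ((X t p) ^ 2 * wordWeight α i p.1 p.2 ^ 2) := by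
      rw [mul_pow]
      calc (∑ t ∈ T, c t * X t p) ^ 2 * wordWeight α i p.1 p.2 ^ 2 ≤ (T.card * ∑ t ∈ T, (c t * X t p) ^ 2) * wordWeight α i p.1 p.2 ^ 2 :=
            mul_le_mul_of_nonneg_right hcs hω
        _ = ∑ t ∈ T, T.card * c t ^ 2 * ((X t p) ^ 2 * wordWeight α i p.1 p.2 ^ 2) := by rw [mul_sum, sum_mul]; exact sum_congr rfl fun t _ => by ring
        _ ≤ ∑ t ∈ T, 25 * 65536 * ((X t p) ^ 2 * wordWeight α i p.1 p.2 ^ 2) := by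
            refine sum_le_sum fun t ht => mul_le_mul_of_nonneg_right ?_ (by positivity)
            exact mul_le_mul hcard (hcle t ht) (sq_nonneg _) (by norm_num)
    refine (ENNReal.ofReal_le_ofReal hreal).trans (le_of_eq ?_)
    rw [ENNReal.ofReal_sum_of_nonneg fun t _ => by positivity]
    exact sum_congr rfl fun t _ => by rw [ENNReal.ofReal_mul (by norm_num)]
  -- measurability of the terms
  have hf4 : ContDiffOn ℝ 4 (uncurry f) strip := hf.of_le (WithTop.coe_le_coe.2 le_top : (4 : WithTop ℕ∞) ≤ ((⊤ : ℕ∞) : WithTop ℕ∞))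
  have hg4 : ContDiffOn ℝ 4 (uncurry g) strip := hgs.of_le (WithTop.coe_le_coe.2 le_top : (4 : WithTop ℕ∞) ≤ ((⊤ : ℕ∞) : WithTop ℕ∞))
  have hmeas : ∀ t ∈ T, AEMeasurable (fun p : ℝ × ℝ => ENNReal.ofReal (25 * 65536) * ENNReal.ofReal ((X t p) ^ 2 * wordWeight α i p.1 p.2 ^ 2)) (volume.restrict strip) := by
    intro t ht
    rw [hT, mem_product, Finset.mem_range, Finset.mem_range] at ht
    have hc1 : ContinuousOn (fun p : ℝ × ℝ => X t p) strip :=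
      (continuousOn_iterate_Dθ_Dz hf4 (show t.2 + t.1 ≤ 4 by omega)).mul (continuousOn_iterate_Dθ_Dz hg4 (show (i - t.2) + (j - t.1) ≤ 4 by omega))
    have hc : ContinuousOn (fun p : ℝ × ℝ => (X t p) ^ 2 * wordWeight α i p.1 p.2 ^ 2) strip := (hc1.pow 2).mul ((continuousOn_wordWeight α i).pow 2)
    exact ((hc.aemeasurable measurableSet_strip).ennreal_ofReal).const_mul _
  -- integrate
  rw [eL2Sq_eq_lintegral_ofReal]
  calc ∫⁻ p in strip, ENNReal.ofReal (((Dθ^[i] (Dz^[j] (f * g))) p.1 p.2 * wordWeight α i p.1 p.2) ^ 2)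
      ≤ ∫⁻ p in strip, ∑ t ∈ T, ENNReal.ofReal (25 * 65536) * ENNReal.ofReal ((X t p) ^ 2 * wordWeight α i p.1 p.2 ^ 2) :=
        setLIntegral_mono' measurableSet_strip hpt
    _ = ∑ t ∈ T, ENNReal.ofReal (25 * 65536) * ∫⁻ p in strip, ENNReal.ofReal ((X t p) ^ 2 * wordWeight α i p.1 p.2 ^ 2) := by
        rw [lintegral_finsetSum' _ hmeas]
        refine sum_congr rfl fun t _ => ?_
        rw [lintegral_const_mul' _ _ ENNReal.ofReal_ne_top]
    _ ≤ ∑ _t ∈ T, ENNReal.ofReal (25 * 65536) * (ENNReal.ofReal (termBC * B ^ 2) * eHkNormSq α 4 g) := by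
        refine sum_le_sum fun t ht => mul_le_mul_right ?_ _
        rw [hT, mem_product, Finset.mem_range, Finset.mem_range] at ht
        have h := lintegral_leibnizTerm_le hα hα10 hB0 hB hg hij (show t.2 ≤ i by omega) (show t.1 ≤ j by omega)
        refine le_trans (le_of_eq (lintegral_congr fun p => ?_)) h
        simp only [hX]; rw [mul_pow]
    _ = T.card * (ENNReal.ofReal (25 * 65536) * (ENNReal.ofReal (termBC * B ^ 2) * eHkNormSq α 4 g)) := by rw [sum_const, nsmul_eq_mul]
    _ ≤ (25:ℝ≥0∞) * (ENNReal.ofReal (25 * 65536) * (ENNReal.ofReal (termBC * B ^ 2) * eHkNormSq α 4 g)) := by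
        refine mul_le_mul_left ?_ _
        exact_mod_cast (show T.card ≤ 25 by exact_mod_cast hcard)
    _ = ENNReal.ofReal (wordBC * B ^ 2) * eHkNormSq α 4 g := by
        rw [← mul_assoc, ← mul_assoc, ← ENNReal.ofReal_ofNat 25, ← ENNReal.ofReal_mul (by norm_num),
          ← ENNReal.ofReal_mul (by norm_num)]
        congr 2; unfold wordBC; ring

/-! ### The product rule -/

/-- The constant of the multiplier product rule at `k = 4`: `30·wordBC`. [folklore] -/
def prodBC : ℝ := 30 * wordBC

/-- `0 ≤ prodBC`. [folklore] -/
theorem prodBC_nonneg : 0 ≤ prodBC := by unfold prodBC; exact mul_nonneg (by norm_num) wordBC_nonneg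

/-- **The product rule at `k = 4` for a multiplier with a.e. word bounds** (the form actually used for
the explicit profile factors): for `0 < α ≤ 10`, `f` smooth on the open strip with, a.e. on the strip,
`|D_z^j f| ≤ B` and `|D_θ^iD_z^j f| ≤ (γ − 1 + sin 2θ)·B` (`i ≥ 1`, `i + j ≤ 4`), and a test function `g`:
`|fg|²_{𝓗⁴} ≤ prodBC·B²·|g|²_{𝓗⁴}`. [cite: ElgindiGhoulMasmoudi2021, §9 Proposition 9.3 (p. 20 of arXiv:1910.14071)] -/
theorem eHkNormSq_mul_le_of_wordBounds {α : ℝ} (hα : 0 < α) (hα10 : α ≤ 10) {f g : ℝ → ℝ → ℝ} (hf : ContDiffOn ℝ ∞ (uncurry f) strip)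
    {B : ℝ} (hB0 : 0 ≤ B) (hB : ∀ᵐ p ∂(volume.restrict strip), ∀ i j : ℕ, i + j ≤ 4 →
      |(Dθ^[i] (Dz^[j] f)) p.1 p.2| ≤ (if i = 0 then 1 else qW α p.2) * B) (hg : StripTest g) :
    eHkNormSq α 4 (f * g) ≤ ENNReal.ofReal (prodBC * B ^ 2) * eHkNormSq α 4 g := by
  set W := ENNReal.ofReal (wordBC * B ^ 2) * eHkNormSq α 4 g with hW
  have hrad : ∀ (h : ℝ → ℝ → ℝ) (j : ℕ), eL2Sq (hkRadialTerm j h) = eL2Sq (fun z θ => (Dθ^[0] (Dz^[j] h)) z θ * wordWeight α 0 z θ) := by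
    intro h j; congr 1
  have hmix : ∀ (h : ℝ → ℝ → ℝ) (i j : ℕ), 1 ≤ i → eL2Sq (hkMixedTerm α i j h) = eL2Sq (fun z θ => (Dθ^[i] (Dz^[j] h)) z θ * wordWeight α i z θ) := by
    intro h i j hi
    have hi0 : i ≠ 0 := by omega
    congr 1; funext z θ; simp [hkMixedTerm, wordWeight, hi0]
  have h1 : ∑ j ∈ range (4 + 1), eL2Sq (hkRadialTerm j (f * g)) ≤ ∑ _j ∈ range (4 + 1), W := by
    refine sum_le_sum fun j hj => ?_
    rw [hrad]
    exact eL2Sq_word_mul_le_of_bounds hα hα10 hf hB0 hB hg (by have := Finset.mem_range.1 hj; omega)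
  have h2 : ∑ i ∈ range (4 + 1), ∑ j ∈ range (4 + 1), (if 1 ≤ i ∧ i + j ≤ 4 then eL2Sq (hkMixedTerm α i j (f * g)) else 0) ≤
      ∑ _i ∈ range (4 + 1), ∑ _j ∈ range (4 + 1), W := by
    refine sum_le_sum fun i _ => sum_le_sum fun j _ => ?_
    split_ifs with hc
    · rw [hmix _ i j hc.1]
      exact eL2Sq_word_mul_le_of_bounds hα hα10 hf hB0 hB hg hc.2
    · exact bot_le
  calc eHkNormSq α 4 (f * g) = (∑ j ∈ range (4 + 1), eL2Sq (hkRadialTerm j (f * g))) +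
        ∑ i ∈ range (4 + 1), ∑ j ∈ range (4 + 1), (if 1 ≤ i ∧ i + j ≤ 4 then eL2Sq (hkMixedTerm α i j (f * g)) else 0) := rfl
    _ ≤ (∑ _j ∈ range (4 + 1), W) + ∑ _i ∈ range (4 + 1), ∑ _j ∈ range (4 + 1), W := add_le_add h1 h2
    _ = 30 * W := by
        simp only [sum_const, card_range, nsmul_eq_mul]; push_cast; ring
    _ = ENNReal.ofReal (prodBC * B ^ 2) * eHkNormSq α 4 g := by
        rw [hW, ← mul_assoc, ← ENNReal.ofReal_ofNat 30, ← ENNReal.ofReal_mul (by norm_num)]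
        congr 2; unfold prodBC; ring

/-- The constant of the second product rule at `k = 4`: `prodBC·wkSupC²`. [folklore] -/
def prodWkC : ℝ := prodBC * wkSupC ^ 2

/-- **The second product rule at `k = 4` (EGM Proposition 9.3 / Elgindi Lemma 8.6) for test functions
`g`**: for `0 < α ≤ 10`, `f` smooth on the open strip with `|f|_{𝓦^{4,∞}} ≤ M` and a test function
`g` of the open strip, `|fg|²_{𝓗⁴} ≤ prodWkC·M²·|g|²_{𝓗⁴}`. [cite: ElgindiGhoulMasmoudi2021, §9 Proposition 9.3 (p. 20 of arXiv:1910.14071); Elgindi2021, §8.1 Lemma 8.6 (p. 25 of arXiv:1904.04795)] -/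
theorem eHkNormSq_mul_le_wk {α : ℝ} (hα : 0 < α) (hα10 : α ≤ 10) {f g : ℝ → ℝ → ℝ} (hf : ContDiffOn ℝ ∞ (uncurry f) strip)
    {M : ℝ} (hM0 : 0 ≤ M) (hM : eWkNorm α 4 f ≤ ENNReal.ofReal M) (hg : StripTest g) :
    eHkNormSq α 4 (f * g) ≤ ENNReal.ofReal (prodWkC * M ^ 2) * eHkNormSq α 4 g := by
  have hwk0 : 0 ≤ wkSupC := by unfold wkSupC; positivity
  have hB : ∀ᵐ p ∂(volume.restrict strip), ∀ i j : ℕ, i + j ≤ 4 →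
      |(Dθ^[i] (Dz^[j] f)) p.1 p.2| ≤ (if i = 0 then 1 else qW α p.2) * (wkSupC * M) := by
    filter_upwards [ae_abs_word_le_of_eWkNorm_le hα hα10 hf hM0 hM] with p hp
    intro i j hij
    have h := hp i j hij
    calc |(Dθ^[i] (Dz^[j] f)) p.1 p.2| ≤ wkSupC * (if i = 0 then 1 else qW α p.2) * M := h
      _ = (if i = 0 then 1 else qW α p.2) * (wkSupC * M) := by ring
  have h := eHkNormSq_mul_le_of_wordBounds hα hα10 hf (by positivity) hB hg
  have e : prodBC * (wkSupC * M) ^ 2 = prodWkC * M ^ 2 := by unfold prodWkC; ring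
  rwa [e] at h

end Elgindi

end Literature.Analysis.FluidPDE
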